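import Summits.Ventures.CertifiedManyBodySolver.Downfold.EmeryScaleBoxChain
import HarnessLib

/-!
# THE TRUE-CORNER BOX RULE FOR THE SCALE COORDINATE: the `t_pp′` step at fixed energy and the two box theorems — for every member of a typed
# three-band box, `t_node((Δ₂, a₁, b₁, c₂); q) ≤ t_node(θ; ε_F(θ; ν)) ≤ t_node((Δ₁, a₂, b₂, c₁); p)` from kernel-decided chain data and two point
# brackets (INFL-3to1-B §B.88 (t)–(v))

Venture CertifiedManyBodySolver, cell `pub/hubbard-downfold` (stage S1; INFLATION-RULES-3to1-B §B.88), seat hubbard-downfold-mod-4 (technique B = band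
level, g36); namespace `Summit.Ventures.CertifiedManyBodySolver.Downfold.Emery`. Everything PROVED (0 sorry). WHAT THIS IS NOT: a statement about any
material; no number lives here; `U = 0` one-body kinematics of the σ model; the chain data of a given typed box live in the instance files
`EmeryScaleBox<Tag>…` (SCREENING-GRADE boxes).

* §1 `cLeaf` — the `t_pp′` direction at FIXED energy through `pathLeaf` (no Fermi-energy channel: the hopping is compared at the energy of the extreme
  `t_pp′` row, §B.88 (j)), with `cLeaf_upper_sound` / `cLeaf_lower_sound`.
* §2 **`box_upper`**: chain (`chainCheckUpper`, `EmeryScaleBoxChain`) + `cLeaf true` over the box + the window of the corner `(Δ₁, a₂, b₂, c₂)` + the floor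
  at `(Δ₂, a₁, b₁, c₂)` ⇒ `scaleT θ (node) (ε_F θ) ≤ t_node((Δ₁, a₂, b₂, c₁); p)` for all members. **`box_lower`** symmetrically.

Sources: three-band model [HybertsenSchluterChristensen1989, Eq. (1)]; energy-linearised one-band image [AndersenEtAl1995, §6]; interval arithmetic
[folklore] (Moore 1966).
-/

noncomputable section

namespace Summit.Ventures.CertifiedManyBodySolver.Downfold.Emery

open Real Set Literature.Analysis.ValidatedNumerics.Numerics

/-! ## §1 The `t_pp′` step at fixed energy -/

/-- Leaf for the `t_pp′` direction at FIXED energy: base row `(Δ, a, b, cP)`, move `(0, 0, 0, dc)`, `σ = 0`; `upper` selects `≤` / `≥`. [folklore] -/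
def cLeaf (upper : Bool) (cP dC : FI) (B : SBox) : Bool :=
  pathLeaf upper B.iD B.iA B.iB cP B.iE (thin 0) (thin 0) (thin 0) dC (thin 0) B.iS

/-- Meaning of `cLeaf true`: `t((Δ, a, b, cP + s·dc); e) ≤ t((Δ, a, b, cP); e)`. [folklore] -/
theorem cLeaf_upper_sound {cP dC : FI} {cPr dc : ℝ} (hcP : FI.mem cPr cP) (hdc : FI.mem dc dC) (B : SBox) (h : cLeaf true cP dC B = true)
    (Δ a b s e : ℝ) (hm : FI.mem Δ B.iD ∧ FI.mem a B.iA ∧ FI.mem b B.iB ∧ FI.mem s B.iS ∧ FI.mem e B.iE) :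
    scaleNodeN Δ a b (cPr + s * dc) e / scaleNodeD Δ a b (cPr + s * dc) e ≤ scaleNodeN Δ a b cPr e / scaleNodeD Δ a b cPr e := by
  obtain ⟨h1, h2, h3, h4, h5⟩ := hm
  have h0 : FI.mem (0 : ℝ) (thin 0) := mem_dirs.2.2
  have := scaleNode_le_of_pathLeaf h h1 h2 h3 hcP h5 h0 h0 h0 hdc h0 h4
  simpa using this

/-- Meaning of `cLeaf false`: `t((Δ, a, b, cP); e) ≤ t((Δ, a, b, cP + s·dc); e)`. [folklore] -/
theorem cLeaf_lower_sound {cP dC : FI} {cPr dc : ℝ} (hcP : FI.mem cPr cP) (hdc : FI.mem dc dC) (B : SBox) (h : cLeaf false cP dC B = true)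
    (Δ a b s e : ℝ) (hm : FI.mem Δ B.iD ∧ FI.mem a B.iA ∧ FI.mem b B.iB ∧ FI.mem s B.iS ∧ FI.mem e B.iE) :
    scaleNodeN Δ a b cPr e / scaleNodeD Δ a b cPr e ≤ scaleNodeN Δ a b (cPr + s * dc) e / scaleNodeD Δ a b (cPr + s * dc) e := by
  obtain ⟨h1, h2, h3, h4, h5⟩ := hm
  have h0 : FI.mem (0 : ℝ) (thin 0) := mem_dirs.2.2
  have := scaleNode_ge_of_pathLeaf h h1 h2 h3 hcP h5 h0 h0 h0 hdc h0 h4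
  simpa using this

/-- A real between two enclosed reals lies in the hull `⟨I.lo, J.hi⟩`. [folklore] -/
theorem mem_hull_of_Icc {x u v : ℝ} {I J : FI} (hu : FI.mem u I) (hv : FI.mem v J) (h1 : u ≤ x) (h2 : x ≤ v) : FI.mem x ⟨I.lo, J.hi⟩ :=
  ⟨hu.1.trans (mul_le_mul_of_nonneg_right h1 SC_pos.le), (mul_le_mul_of_nonneg_right h2 SC_pos.le).trans hv.2⟩

/-- `(FI.ofFrac p q).lo / SC ≤ p/q` (`q > 0`). [folklore] -/
theorem ofFrac_lo_div_le (p : ℤ) {q : ℕ} (hq : 0 < q) : ((FI.ofFrac p q).lo : ℝ) / SC ≤ (p : ℝ) / q := FI.lo_div_le (FI.mem_ofFrac p hq)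

/-- `p/q ≤ (FI.ofFrac p q).hi / SC` (`q > 0`). [folklore] -/
theorem le_ofFrac_hi_div (p : ℤ) {q : ℕ} (hq : 0 < q) : (p : ℝ) / q ≤ ((FI.ofFrac p q).hi : ℝ) / SC := FI.le_hi_div (FI.mem_ofFrac p hq)

/-! ## §2 The box theorems -/

section Box

variable {cN cP W0 ID IA IB IEc ID1 IA2 IB2 ID2 IA1 IB1 : FI} {whlo wA wB wD wC : ℤ} {nodes : List ANode} {nC : ℕ}
  {ν Δ₁ Δ₂ a₁ a₂ b₁ b₂ c₁ c₂ p : ℝ}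

/-- **THE BOX THEOREM, UPPER SIDE.** Typed box `[Δ₁, Δ₂] × [a₁, a₂] × [b₁, b₂] × [c₁, c₂]` (`Δ₁, a₁ > 0`, `b₁ ≥ c₂ ≥ c₁ ≥ 0`), filling `ν`; the UPPER chain
data checked with `cN ∋ c₂`, `cP ∋ c₁`, corner families `∋ (Δ₁, a₂, b₂)`, window `W0 ∋ ε_F(Δ₁, a₂, b₂, c₂)` (a point bracket), crude floor
`whlo/SC ≤ ε_F(Δ₂, a₁, b₁, c₂)`; the fixed-energy `t_pp′` leaf checked over the box × `[0, c₂ − c₁]` × an energy window `IEc ⊇ [ε_F(Δ₂, a₁, b₁, c₂),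
ε_F(Δ₁, a₂, b₂, c₂)]`; regime scalars. THEN for every member `θ` and `p ≤ ε_F(Δ₁, a₂, b₂, c₂)`, `p > 0`:
**`t_node(θ; ε_F(θ; ν)) ≤ t_node((Δ₁, a₂, b₂, c₁); p)`** — the true-corner ceiling of the scale coordinate. [folklore] -/
theorem box_upper (hchain : chainCheckUpper cN cP whlo ID1 IA2 IB2 wA wB wD W0 nodes = true) (hc : SBox.deep (cLeaf true cP (thin (SC : ℤ))) nC ⟨ID, IA, IB, ⟨0, wC⟩, IEc⟩ = true)
    (hcN : FI.mem c₂ cN) (hcP : FI.mem c₁ cP) (hD1 : FI.mem Δ₁ ID1) (hA2 : FI.mem a₂ IA2) (hB2 : FI.mem b₂ IB2) (hν0 : 0 < ν) (hν1 : ν < 1)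
    (hΔ₁ : 0 < Δ₁) (ha₁ : 0 < a₁) (hc₁ : 0 ≤ c₁) (hc12 : c₁ ≤ c₂) (hcb : c₂ ≤ b₁) (hwD : (Δ₂ - Δ₁) * SC ≤ (wD : ℝ)) (hwA : (a₂ - a₁) * SC ≤ (wA : ℝ))
    (hwB : (b₂ - b₁) * SC ≤ (wB : ℝ)) (hwC : (c₂ - c₁) * SC ≤ (wC : ℝ)) (hW0 : FI.mem (fermiEnergyOf Δ₁ a₂ b₂ c₂ ν) W0)
    (hwhlo : (whlo : ℝ) / SC ≤ fermiEnergyOf Δ₂ a₁ b₁ c₂ ν)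
    (hID : ∀ x, Δ₁ ≤ x → x ≤ Δ₂ → FI.mem x ID) (hIA : ∀ x, a₁ ≤ x → x ≤ a₂ → FI.mem x IA) (hIB : ∀ x, b₁ ≤ x → x ≤ b₂ → FI.mem x IB)
    (hIEc : ∀ x, fermiEnergyOf Δ₂ a₁ b₁ c₂ ν ≤ x → x ≤ fermiEnergyOf Δ₁ a₂ b₂ c₂ ν → FI.mem x IEc)
    (hregm : c₂ * fermiEnergyOf Δ₁ a₂ b₂ c₁ ν < a₁ ^ 2) (hregq : b₂ * Δ₂ < 4 * a₁ ^ 2) (hp : p ≤ fermiEnergyOf Δ₁ a₂ b₂ c₂ ν) (hp0 : 0 < p)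
    {Δ a b c : ℝ} (hΔ : Δ ∈ Icc Δ₁ Δ₂) (ha : a ∈ Icc a₁ a₂) (hb : b ∈ Icc b₁ b₂) (hcc : c ∈ Icc c₁ c₂) :
    scaleT Δ a b c (xNode Δ a b c (fermiEnergyOf Δ a b c ν)) (xNode Δ a b c (fermiEnergyOf Δ a b c ν)) (fermiEnergyOf Δ a b c ν) ≤
      scaleNodeN Δ₁ a₂ b₂ c₁ p / scaleNodeD Δ₁ a₂ b₂ c₁ p := by
  have hΔ0 : 0 < Δ := lt_of_lt_of_le hΔ₁ hΔ.1
  have ha0 : 0 < a := lt_of_lt_of_le ha₁ ha.1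
  have hc0 : 0 ≤ c := hc₁.trans hcc.1
  have hcb' : c ≤ b := (hcc.2.trans hcb).trans hb.1
  have hc₂0 : 0 ≤ c₂ := hc₁.trans hc12
  have hb0 : 0 ≤ b := hc0.trans hcb'
  set E := fermiEnergyOf Δ a b c ν with hE
  set E₂ := fermiEnergyOf Δ a b c₂ ν with hE₂
  have hE0 : 0 < E := fermiEnergyOf_pos hΔ0 ha0.ne' hc0 hb0 hν0 hν1
  have hE₂0 : 0 < E₂ := fermiEnergyOf_pos hΔ0 ha0.ne' hc₂0 hb0 hν0 hν1
  -- ε_F is antitone in t_pp′ and monotone in the box (two-corner rule)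
  have hEE₂ : E₂ ≤ E := (fermiEnergyOf_mem_Icc_of_mem_box' (Δ₁ := Δ) (Δ₂ := Δ) (a₁ := a) (a₂ := a) (b₁ := b) (b₂ := b) (c₁ := c) (c₂ := c₂)
    hΔ0 ha0 hb0 hc0 ⟨le_rfl, le_rfl⟩ ⟨le_rfl, le_rfl⟩ ⟨le_rfl, le_rfl⟩ ⟨le_rfl, hcc.2⟩ hν0 hν1).1
  have hEtop : E ≤ fermiEnergyOf Δ₁ a₂ b₂ c₁ ν := (fermiEnergyOf_mem_Icc_of_mem_box' hΔ₁ ha₁ (hc₂0.trans hcb) hc₁ hΔ ha hb hcc hν0 hν1).2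
  have hE₂win : fermiEnergyOf Δ₂ a₁ b₁ c₂ ν ≤ E₂ ∧ E₂ ≤ fermiEnergyOf Δ₁ a₂ b₂ c₂ ν :=
    fermiEnergyOf_mem_Icc_of_mem_box' hΔ₁ ha₁ (hc₂0.trans hcb) hc₂0 hΔ ha hb ⟨le_rfl, le_rfl⟩ hν0 hν1
  -- (1) closed form and energy antitonicity at θ: t(θ; E) ≤ t(θ; E₂)
  rw [scaleT_node_eq (by linarith) hE0.le hc0 hcb' ha0.ne']
  have hm : c * E < a ^ 2 := by
    have h1 : c * E ≤ c₂ * fermiEnergyOf Δ₁ a₂ b₂ c₁ ν := mul_le_mul hcc.2 hEtop hE0.le hc₂0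
    have h2 : a₁ ^ 2 ≤ a ^ 2 := by nlinarith [ha.1]
    linarith
  have hq : b * Δ < 4 * a ^ 2 := by
    have h1 : b * Δ ≤ b₂ * Δ₂ := mul_le_mul hb.2 hΔ.2 hΔ0.le (hb0.trans hb.2)
    have h2 : a₁ ^ 2 ≤ a ^ 2 := by nlinarith [ha.1]
    linarith
  have step1 := scaleNode_div_antitone hΔ0 hc0 hcb' ha0.ne' hE₂0 hEE₂ hm hq
  -- (2) the t_pp′ step at fixed energy E₂: t((Δ,a,b,c); E₂) ≤ t((Δ,a,b,c₁); E₂)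
  have h1 : FI.mem (1 : ℝ) (thin (SC : ℤ)) := mem_dirs.1
  have hsC : FI.mem (c - c₁) (⟨0, wC⟩ : FI) := by
    refine ⟨by simpa using mul_nonneg (sub_nonneg.2 hcc.1) SC_pos.le, ?_⟩
    have : (c - c₁) * SC ≤ (c₂ - c₁) * SC := mul_le_mul_of_nonneg_right (by linarith [hcc.2]) SC_pos.le
    exact this.trans hwC
  have step2 := SBox.forall_of_deep (cLeaf_upper_sound hcP h1) nC _ hc Δ a b (c - c₁) E₂
    ⟨hID Δ hΔ.1 hΔ.2, hIA a ha.1 ha.2, hIB b hb.1 hb.2, hsC, hIEc E₂ hE₂win.1 hE₂win.2⟩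
  simp only [mul_one, add_sub_cancel] at step2
  -- (3) the chain on the c₁-hopping / c₂-energy rows
  have step3 := chain_upper hchain hcN hcP hD1 hA2 hB2 hν0 hν1 hΔ.1 (le_trans (mul_le_mul_of_nonneg_right (by linarith [hΔ.2]) SC_pos.le) hwD)
    ha.2 (le_trans (mul_le_mul_of_nonneg_right (by linarith [ha.1]) SC_pos.le) hwA) hb.2
    (le_trans (mul_le_mul_of_nonneg_right (by linarith [hb.1]) SC_pos.le) hwB) hW0 (by
      intro Δ' a' b' h1' h2' h3' h4' h5' h6'
      exact hwhlo.trans (fermiEnergyOf_mem_Icc_of_mem_box' hΔ₁ ha₁ (hc₂0.trans hcb) hc₂0 ⟨h1', h2'.trans hΔ.2⟩ ⟨ha.1.trans h3', h4'⟩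
        ⟨hb.1.trans h5', h6'⟩ ⟨le_rfl, le_rfl⟩ hν0 hν1).1)
  -- (4) the corner at its bracket floor p
  have hmV : c₁ * fermiEnergyOf Δ₁ a₂ b₂ c₂ ν < a₂ ^ 2 := by
    have h1 : c₁ * fermiEnergyOf Δ₁ a₂ b₂ c₂ ν ≤ c₂ * fermiEnergyOf Δ₁ a₂ b₂ c₁ ν := by
      refine mul_le_mul hc12 ?_ (fermiEnergyOf_pos hΔ₁ (lt_of_lt_of_le ha₁ (ha.1.trans ha.2)).ne' hc₂0 (hc₂0.trans (hcb.trans (hb.1.trans hb.2))) hν0 hν1).le hc₂0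
      exact (fermiEnergyOf_mem_Icc_of_mem_box' hΔ₁ ha₁ (hc₂0.trans hcb) hc₁ (Δ := Δ₁) (a := a₂) (b := b₂) (c := c₂) ⟨le_rfl, hΔ.1.trans hΔ.2⟩
        ⟨ha.1.trans ha.2, le_rfl⟩ ⟨hb.1.trans hb.2, le_rfl⟩ ⟨hc12, le_rfl⟩ hν0 hν1).2
    have h2 : a₁ ^ 2 ≤ a₂ ^ 2 := by nlinarith [ha.1.trans ha.2]
    linarith
  have hqV : b₂ * Δ₁ < 4 * a₂ ^ 2 := by
    have h1 : b₂ * Δ₁ ≤ b₂ * Δ₂ := mul_le_mul_of_nonneg_left (hΔ.1.trans hΔ.2) (hb0.trans hb.2)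
    have h2 : a₁ ^ 2 ≤ a₂ ^ 2 := by nlinarith [ha.1.trans ha.2]
    linarith
  have step4 := scaleNode_div_antitone hΔ₁ hc₁ (hc12.trans (hcb.trans (hb.1.trans hb.2))) (lt_of_lt_of_le ha₁ (ha.1.trans ha.2)).ne' hp0 hp hmV hqV
  exact step1.trans (step2.trans (step3.trans step4))

/-- **THE BOX THEOREM, LOWER SIDE.** Same box; the LOWER chain data checked with `cN ∋ c₁`, `cP ∋ c₂`, corner families `∋ (Δ₂, a₁, b₁)`, window
`W0 ∋ ε_F(Δ₂, a₁, b₁, c₁)`; the fixed-energy `t_pp′` leaf (`cLeaf false`, base `c₂`, direction `−1`) over the box × `[0, c₂ − c₁]` × `IEc ⊇ [ε_F(Δ₂, a₁, b₁,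
c₁), ε_F(Δ₁, a₂, b₂, c₁)]`. THEN for every member `θ` and `q ≥ ε_F(Δ₂, a₁, b₁, c₁)` in the regime: **`t_node((Δ₂, a₁, b₁, c₂); q) ≤ t_node(θ; ε_F(θ; ν))`**.
[folklore] -/
theorem box_lower (hchain : chainCheckLower cN cP ID2 IA1 IB1 wA wB wD W0 nodes = true)
    (hc : SBox.deep (cLeaf false cP (thin (-(SC : ℤ)))) nC ⟨ID, IA, IB, ⟨0, wC⟩, IEc⟩ = true)
    (hcN : FI.mem c₁ cN) (hcP : FI.mem c₂ cP) (hD2 : FI.mem Δ₂ ID2) (hA1 : FI.mem a₁ IA1) (hB1 : FI.mem b₁ IB1) (hν0 : 0 < ν) (hν1 : ν < 1)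
    (hΔ₁ : 0 < Δ₁) (ha₁ : 0 < a₁) (hc₁ : 0 ≤ c₁) (hc12 : c₁ ≤ c₂) (hcb : c₂ ≤ b₁) (hwD : (Δ₂ - Δ₁) * SC ≤ (wD : ℝ)) (hwA : (a₂ - a₁) * SC ≤ (wA : ℝ))
    (hwB : (b₂ - b₁) * SC ≤ (wB : ℝ)) (hwC : (c₂ - c₁) * SC ≤ (wC : ℝ)) (hW0 : FI.mem (fermiEnergyOf Δ₂ a₁ b₁ c₁ ν) W0)
    (hID : ∀ x, Δ₁ ≤ x → x ≤ Δ₂ → FI.mem x ID) (hIA : ∀ x, a₁ ≤ x → x ≤ a₂ → FI.mem x IA) (hIB : ∀ x, b₁ ≤ x → x ≤ b₂ → FI.mem x IB)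
    (hIEc : ∀ x, fermiEnergyOf Δ₂ a₁ b₁ c₁ ν ≤ x → x ≤ fermiEnergyOf Δ₁ a₂ b₂ c₁ ν → FI.mem x IEc)
    (hregm : c₂ * fermiEnergyOf Δ₁ a₂ b₂ c₁ ν < a₁ ^ 2) (hregq : b₂ * Δ₂ < 4 * a₁ ^ 2) {q : ℝ} (hq : fermiEnergyOf Δ₂ a₁ b₁ c₁ ν ≤ q)
    (hqreg : c₂ * q < a₁ ^ 2) {Δ a b c : ℝ} (hΔ : Δ ∈ Icc Δ₁ Δ₂) (ha : a ∈ Icc a₁ a₂) (hb : b ∈ Icc b₁ b₂) (hcc : c ∈ Icc c₁ c₂) :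
    scaleNodeN Δ₂ a₁ b₁ c₂ q / scaleNodeD Δ₂ a₁ b₁ c₂ q ≤
      scaleT Δ a b c (xNode Δ a b c (fermiEnergyOf Δ a b c ν)) (xNode Δ a b c (fermiEnergyOf Δ a b c ν)) (fermiEnergyOf Δ a b c ν) := by
  have hΔ0 : 0 < Δ := lt_of_lt_of_le hΔ₁ hΔ.1
  have hΔ₂ : 0 < Δ₂ := lt_of_lt_of_le hΔ0 hΔ.2
  have ha0 : 0 < a := lt_of_lt_of_le ha₁ ha.1
  have hc0 : 0 ≤ c := hc₁.trans hcc.1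
  have hc₂0 : 0 ≤ c₂ := hc₁.trans hc12
  have hcb' : c ≤ b := (hcc.2.trans hcb).trans hb.1
  have hb₁0 : 0 ≤ b₁ := hc₂0.trans hcb
  have hb0 : 0 ≤ b := hb₁0.trans hb.1
  set E := fermiEnergyOf Δ a b c ν with hE
  set E₁ := fermiEnergyOf Δ a b c₁ ν with hE₁
  have hE0 : 0 < E := fermiEnergyOf_pos hΔ0 ha0.ne' hc0 hb0 hν0 hν1
  have hEE₁ : E ≤ E₁ := (fermiEnergyOf_mem_Icc_of_mem_box' (Δ₁ := Δ) (Δ₂ := Δ) (a₁ := a) (a₂ := a) (b₁ := b) (b₂ := b) (c₁ := c₁) (c₂ := c)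
    hΔ0 ha0 hb0 hc₁ ⟨le_rfl, le_rfl⟩ ⟨le_rfl, le_rfl⟩ ⟨le_rfl, le_rfl⟩ ⟨hcc.1, le_rfl⟩ hν0 hν1).2
  have hE₁win : fermiEnergyOf Δ₂ a₁ b₁ c₁ ν ≤ E₁ ∧ E₁ ≤ fermiEnergyOf Δ₁ a₂ b₂ c₁ ν :=
    fermiEnergyOf_mem_Icc_of_mem_box' hΔ₁ ha₁ hb₁0 hc₁ hΔ ha hb ⟨le_rfl, le_rfl⟩ hν0 hν1
  -- (1) closed form and antitonicity at θ: t(θ; E₁) ≤ t(θ; E)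
  rw [scaleT_node_eq (by linarith) hE0.le hc0 hcb' ha0.ne']
  have hm : c * E₁ < a ^ 2 := by
    have h1 : c * E₁ ≤ c₂ * fermiEnergyOf Δ₁ a₂ b₂ c₁ ν := mul_le_mul hcc.2 hE₁win.2 (hE0.le.trans hEE₁) hc₂0
    have h2 : a₁ ^ 2 ≤ a ^ 2 := by nlinarith [ha.1]
    linarith
  have hqq : b * Δ < 4 * a ^ 2 := by
    have h1 : b * Δ ≤ b₂ * Δ₂ := mul_le_mul hb.2 hΔ.2 hΔ0.le (hb0.trans hb.2)
    have h2 : a₁ ^ 2 ≤ a ^ 2 := by nlinarith [ha.1]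
    linarith
  have step1 := scaleNode_div_antitone hΔ0 hc0 hcb' ha0.ne' hE0 hEE₁ hm hqq
  -- (2) the t_pp′ step at fixed energy E₁: t((Δ,a,b,c₂); E₁) ≤ t((Δ,a,b,c); E₁), with c = c₂ + (c₂ − c)(−1)
  have hm1 : FI.mem (-1 : ℝ) (thin (-(SC : ℤ))) := mem_dirs.2.1
  have hsC : FI.mem (c₂ - c) (⟨0, wC⟩ : FI) := by
    refine ⟨by simpa using mul_nonneg (sub_nonneg.2 hcc.2) SC_pos.le, ?_⟩
    have : (c₂ - c) * SC ≤ (c₂ - c₁) * SC := mul_le_mul_of_nonneg_right (by linarith [hcc.1]) SC_pos.le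
    exact this.trans hwC
  have step2 := SBox.forall_of_deep (cLeaf_lower_sound hcP hm1) nC _ hc Δ a b (c₂ - c) E₁
    ⟨hID Δ hΔ.1 hΔ.2, hIA a ha.1 ha.2, hIB b hb.1 hb.2, hsC, hIEc E₁ hE₁win.1 hE₁win.2⟩
  have ec : c₂ + (c₂ - c) * (-1) = c := by ring
  rw [ec] at step2
  -- (3) the chain on the c₂-hopping / c₁-energy rows
  have step3 := chain_lower hchain hcN hcP hD2 hA1 hB1 hc₁ hν0 hν1 hΔ0 ha₁ hb₁0 hΔ.2
    (le_trans (mul_le_mul_of_nonneg_right (by linarith [hΔ.1]) SC_pos.le) hwD) ha.1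
    (le_trans (mul_le_mul_of_nonneg_right (by linarith [ha.2]) SC_pos.le) hwA) hb.1
    (le_trans (mul_le_mul_of_nonneg_right (by linarith [hb.2]) SC_pos.le) hwB) hW0
  -- (4) the corner above its bracket ceiling q
  have hΛ0 : 0 < fermiEnergyOf Δ₂ a₁ b₁ c₁ ν := fermiEnergyOf_pos hΔ₂ ha₁.ne' hc₁ hb₁0 hν0 hν1
  have hqV : b₁ * Δ₂ < 4 * a₁ ^ 2 := by
    have h1 : b₁ * Δ₂ ≤ b₂ * Δ₂ := mul_le_mul_of_nonneg_right (hb.1.trans hb.2) hΔ₂.le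
    linarith
  have step4 := scaleNode_div_antitone hΔ₂ hc₂0 hcb ha₁.ne' hΛ0 hq hqreg hqV
  exact step4.trans (step3.trans (step2.trans step1))

end Box

end Summit.Ventures.CertifiedManyBodySolver.Downfold.Emery
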